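import Summits.AtomisticToContinuum.Crystallization.Theorems.FrustratedLawDichotomyStrainedPatchHomEntryLevelClosure

/-!
# SEMANTIC CURRENCY for the `(H)` hcp certificate: the box verdict `semOKH μ` («the leaf conclusion holds at every point of the box»), CUT GLUE at
# ARBITRARY integer cut points, box antitonicity, level antitonicity, and the root consumers
# (27623 `(H) HomFloor`, hcp half; hand-1 g39; critic rows 1453 P3 / 1455 (A)(3) / 1460 (5) «kernel mode for (F₆′): trees at μ₇₈ … smoke of the final certification block»)

decomp-a2c hand-1 g39 (crux `AperiodicFrustratedLawGap`, stmt-AtomisticToContinuum-27623).  WHY THIS FILE.  The record theorems of `(F₆′)`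
(`…RecordJunctionFallbackLeverF6p4` §2) consume ONE root fact `∃ t, treeOK (entryLeafOKHT4A2QQDCRS4 μ₇₈) t rootCH rootWH = true`, and `treeOK` trees are
MIDPOINT HALVINGS of the root cube `rootCH ± rootWH` (`…HomCertTree.treeOK`, glue `…HomEntryTreeShard.exists_tree_split_lit`): every node box is dyadically
aligned in all twelve coordinates.  The production slab cells of the lane (`…HomEntryLeafHTA2QCell*`: the bulk cells, the entry-table cells, the eleven T0
cells) are NOT such nodes and cannot be: the HT certificate expands around the BOX CENTRE shuffle `cenShuf c` (`…HomCurvCentreKit`), so a cell must be centred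
ON the sheet `ξ⋆(U_c)` (slope at the reference `g₀ ≈ 5·10⁻⁶·SC` for the landed cells; a dyadic ξ-node off the sheet by its own half-width `≈ 2·10⁻³` has
`g₀ ≈ 10⁻²·SC ≫ Gs♯ ≈ 3·10⁻³·SC` and does not certify), and its ξ half-widths are the natural shuffle box `1.1·|J|w` (non-dyadic).  So the final
certification block «cells ⟶ root fact» had no typed path.  This file supplies it WITHOUT touching any kit or any landed cell:

* `semOKH μ c w` — the SEMANTIC hcp box verdict: the `hver` conclusion of `…HomEntryFlipHcp.hcpHalf_of_entryTreeShuf` holds at every admissible `(U, ξ)` of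
  the box (classical `decide`, never evaluated — exactly like v3 / v4); `semOKH_sound` is a tautology;
* every certificate of the lane lands in it: `semOKH_of_HT4A2QQDCRS3` (v3), `semOKH_of_HT4A2QQDCRS4` (v4, level-closed), `semOKH_of_treeOK` (any certificate
  tree over any sound verdict), `semOKH_of_exists_tree3/4` (the `okS3_… / okS4_…` ∃-tree facts of the cells);
* ★★ `semOKH_of_cut` — GLUE ALONG ANY COORDINATE AT ANY INTEGER CUT POINT (the two pieces `[c−w, p]`, `[p, c+w]` need not be halves; stated with literal
  `Function.update` equations like `exists_tree_split_lit`, three linear integer side conditions), so a k-d partition with cuts placed AROUND the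
  sheet-centred natural cells assembles to the root; midpoint halving is the special case `semOKH_of_halves`;
* ★ `semOKH_anti_box` — a certified box certifies every sub-box (integer containment per coordinate), so an already-landed cell serves any partition
  piece inside it; ★ `semOKH_mono_level` — antitone in the level (`μ' ≤ μ`), so `muRec` cells serve `μ₇₈` (and `μ₇₄`) exactly like `…LevelClosure`;
* ★★★ ROOT CONSUMERS: `hcpHalf_of_semOKH` (the hcp half from the ONE fact `semOKH μ rootCH rootWH = true`) and `homFloor_of_entryTree6RBKP4_semOKH`
  (`(H) HomFloor m` from the fcc ∃-tree over v4 and the hcp semantic root fact, any `m` with `2 (m + e_W) SC ≤ μ`); `semOKH_root_of_exists_tree4` converts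
  the tree-shaped root hypothesis of record into the semantic one (so nothing typed so far is lost; the `(F₆′)` twins over `semOKH` are a three-line
  composition in hand-2's lane).

One classical definition (`semOKH`) + the coordinate map `hcpCoord` and the statement shape `HcpLeafGoal`; 0 sorry; standard axioms; no instances / notation / `#eval`.
`--supports stmt-AtomisticToContinuum-27623`.
-/

noncomputable section

namespace Summit.AtomisticToContinuum.Crystallization.Theorems.FrustratedLawDichotomyStrainedPatchHomEntryLeafHT

open scoped BigOperators RealInnerProductSpace
open Literature.Analysis.ValidatedNumerics.Numerics
open Summit.AtomisticToContinuum.Crystallization.Theorems.ChargedEnergyGapNegative (E3)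
open Summit.AtomisticToContinuum.Crystallization.Theorems.FrustratedLawDichotomySchurCut (effPot w₄₅ ω₄)
open Summit.AtomisticToContinuum.Crystallization.Theorems.FrustratedLawDichotomyAveragingRuleTightFree (TightNearCap BadNearCap)
open Summit.AtomisticToContinuum.Crystallization.Theorems.FrustratedLawDichotomyExemptAbsorption (ExemptNear)
open Summit.AtomisticToContinuum.Crystallization.Theorems.FrustratedLawDichotomyStrainedPatchHomSplit (ExRec latPt hexFrame hcpShift HomFloor)
open Summit.AtomisticToContinuum.Crystallization.Theorems.FrustratedLawDichotomyStrainedPatchHomPrunedPolar (homFloor_of_prunedBoxSums_selfAdjoint)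
open Summit.AtomisticToContinuum.Crystallization.Theorems.FrustratedLawDichotomyStrainedPatchHomCertTree (CertTree treeOK)
open Summit.AtomisticToContinuum.Crystallization.Theorems.FrustratedLawDichotomyStrainedPatchHomEntryGram (rootC rootW)
open Summit.AtomisticToContinuum.Crystallization.Theorems.FrustratedLawDichotomyStrainedPatchHomEntryGramHcp (rootCH rootWH)
open Summit.AtomisticToContinuum.Crystallization.Theorems.FrustratedLawDichotomyStrainedPatchHomEntryFlipHcp (HcpDich hcpHalf_of_entryTreeShuf)

/-! ## §1. Statement shapes: the point coordinates of `(U, ξ)` and the leaf conclusion at level `μ` -/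

/-- The twelve box coordinates of a pair `(U, ξ)`: the nine entries `(U e_b)_a` and the three shuffle coordinates `ξ_i`. -/
def hcpCoord (U : E3 →L[ℝ] E3) (ξ : E3) : (Fin 3 × Fin 3) ⊕ Fin 3 → ℝ :=
  Sum.elim (fun ab => (U (EuclideanSpace.single ab.2 (1 : ℝ))) ab.1) (fun i => ξ i)

/-- The conclusion of the hcp leaf soundness theorems (`hver` shape of `…HomEntryFlipHcp.hcpHalf_of_entryTreeShuf`) at level `μ` for the pair `(U, ξ)`:
the geometric trichotomy for every finite cluster presenting the strained hcp environment, or the energy floor `μ/SC`. -/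
def HcpLeafGoal (μ : ℤ) (U : E3 →L[ℝ] E3) (ξ : E3) : Prop :=
  (∀ (M : ℕ) (z : Fin M → E3) (cc : Fin M), Function.Injective z →
      Set.range z = {x : E3 | dist x (z cc) ≤ 133 / 10 ∧ ∃ a : Fin 3 → ℤ,
        x = z cc + latPt U hexFrame a ∨ x = z cc + latPt U hexFrame a + U (hcpShift + ξ)} →
      TightNearCap (9 / 5) (3 / 2) z cc ∨ ExemptNear (9 / 5) ExRec z cc ∨ BadNearCap (9 / 5) (3 / 2) z cc) ∨
    (μ : ℝ) / SC ≤ ∑ b ∈ (Fintype.piFinset fun _ : Fin 3 => Finset.Icc (-7 : ℤ) 7).filter (fun b => b ≠ 0), effPot w₄₅ ω₄ (3 / 400) ‖latPt U hexFrame b‖ +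
      ∑ b ∈ (Fintype.piFinset fun _ : Fin 3 => Finset.Icc (-7 : ℤ) 7), effPot w₄₅ ω₄ (3 / 400) ‖latPt U hexFrame b + U (hcpShift + ξ)‖

/-- The two box hypotheses of the `hver` shape are the twelve-coordinate membership. [formal bookkeeping] -/
theorem inHcpBox_iff (c w : (Fin 3 × Fin 3) ⊕ Fin 3 → ℤ) (U : E3 →L[ℝ] E3) (ξ : E3) :
    (∀ k, |hcpCoord U ξ k - (c k : ℝ) / SC| ≤ (w k : ℝ) / SC) ↔
      (∀ ab : Fin 3 × Fin 3, |(U (EuclideanSpace.single ab.2 (1 : ℝ))) ab.1 - (c (Sum.inl ab) : ℝ) / SC| ≤ (w (Sum.inl ab) : ℝ) / SC) ∧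
      (∀ i : Fin 3, |ξ i - (c (Sum.inr i) : ℝ) / SC| ≤ (w (Sum.inr i) : ℝ) / SC) := by
  constructor
  · intro h
    exact ⟨fun ab => by simpa [hcpCoord] using h (Sum.inl ab), fun i => by simpa [hcpCoord] using h (Sum.inr i)⟩
  · rintro ⟨hU, hξ⟩ k
    rcases k with ab | i
    · simpa [hcpCoord] using hU ab
    · simpa [hcpCoord] using hξ i

/-- The leaf conclusion is ANTITONE in the level. [arithmetic] -/
theorem hcpLeafGoal_mono {μ μ' : ℤ} (hle : μ' ≤ μ) {U : E3 →L[ℝ] E3} {ξ : E3} (h : HcpLeafGoal μ U ξ) : HcpLeafGoal μ' U ξ := by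
  rcases h with h | h
  · exact Or.inl h
  · exact Or.inr ((level_div_SC_mono hle).trans h)

/-! ## §2. The semantic box verdict -/

/-- ★ **THE SEMANTIC hcp BOX VERDICT at level `μ`**: the leaf conclusion holds at every self-adjoint `U` with `‖U − 1‖ ≤ 1/4` and every wedge shuffle
`ξ` (`0 ≤ ξ₀`, `0 ≤ ξ₂`) of the box.  Classical `decide`, never evaluated by the kernel (like v3 / v4): facts enter through `semOKH_of_…` below. -/
def semOKH (μ : ℤ) (c w : (Fin 3 × Fin 3) ⊕ Fin 3 → ℤ) : Bool :=
  @decide (∀ (U : E3 →L[ℝ] E3) (ξ : E3), (∀ v v' : E3, ⟪U v, v'⟫ = ⟪v, U v'⟫) → ‖U - 1‖ ≤ 1 / 4 → (∀ k, |hcpCoord U ξ k - (c k : ℝ) / SC| ≤ (w k : ℝ) / SC) → 0 ≤ ξ 0 → 0 ≤ ξ 2 →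
      HcpLeafGoal μ U ξ) (Classical.propDecidable _)

/-- Introduction: a pointwise proof of the leaf conclusion on the box certifies the box. [formal bookkeeping] -/
theorem semOKH_of_forall {μ : ℤ} {c w : (Fin 3 × Fin 3) ⊕ Fin 3 → ℤ}
    (h : ∀ (U : E3 →L[ℝ] E3) (ξ : E3), (∀ v v' : E3, ⟪U v, v'⟫ = ⟪v, U v'⟫) → ‖U - 1‖ ≤ 1 / 4 → (∀ k, |hcpCoord U ξ k - (c k : ℝ) / SC| ≤ (w k : ℝ) / SC) → 0 ≤ ξ 0 → 0 ≤ ξ 2 →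
      HcpLeafGoal μ U ξ) : semOKH μ c w = true :=
  @decide_eq_true _ (Classical.propDecidable _) h

/-- Elimination: a certified box yields the leaf conclusion at every admissible point. [formal bookkeeping] -/
theorem semOKH_forall {μ : ℤ} {c w : (Fin 3 × Fin 3) ⊕ Fin 3 → ℤ} (h : semOKH μ c w = true) :
    ∀ (U : E3 →L[ℝ] E3) (ξ : E3), (∀ v v' : E3, ⟪U v, v'⟫ = ⟪v, U v'⟫) → ‖U - 1‖ ≤ 1 / 4 → (∀ k, |hcpCoord U ξ k - (c k : ℝ) / SC| ≤ (w k : ℝ) / SC) → 0 ≤ ξ 0 → 0 ≤ ξ 2 →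
      HcpLeafGoal μ U ξ :=
  @of_decide_eq_true _ (Classical.propDecidable _) h

/-- ★ **SOUNDNESS in the `hver` shape** (a tautology by construction). [formal bookkeeping] -/
theorem semOKH_sound {μ : ℤ} {c w : (Fin 3 × Fin 3) ⊕ Fin 3 → ℤ} (h : semOKH μ c w = true) (U : E3 →L[ℝ] E3) (ξ : E3)
    (hsa : ∀ v v' : E3, ⟪U v, v'⟫ = ⟪v, U v'⟫) (hU : ‖U - 1‖ ≤ 1 / 4)
    (hbox : ∀ ab : Fin 3 × Fin 3, |(U (EuclideanSpace.single ab.2 (1 : ℝ))) ab.1 - (c (Sum.inl ab) : ℝ) / SC| ≤ (w (Sum.inl ab) : ℝ) / SC)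
    (hξ : ∀ i : Fin 3, |ξ i - (c (Sum.inr i) : ℝ) / SC| ≤ (w (Sum.inr i) : ℝ) / SC) (h0 : 0 ≤ ξ 0) (h2 : 0 ≤ ξ 2) :
    (∀ (M : ℕ) (z : Fin M → E3) (cc : Fin M), Function.Injective z →
        Set.range z = {x : E3 | dist x (z cc) ≤ 133 / 10 ∧ ∃ a : Fin 3 → ℤ,
          x = z cc + latPt U hexFrame a ∨ x = z cc + latPt U hexFrame a + U (hcpShift + ξ)} →
        TightNearCap (9 / 5) (3 / 2) z cc ∨ ExemptNear (9 / 5) ExRec z cc ∨ BadNearCap (9 / 5) (3 / 2) z cc) ∨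
      (μ : ℝ) / SC ≤ ∑ b ∈ (Fintype.piFinset fun _ : Fin 3 => Finset.Icc (-7 : ℤ) 7).filter (fun b => b ≠ 0), effPot w₄₅ ω₄ (3 / 400) ‖latPt U hexFrame b‖ +
        ∑ b ∈ (Fintype.piFinset fun _ : Fin 3 => Finset.Icc (-7 : ℤ) 7), effPot w₄₅ ω₄ (3 / 400) ‖latPt U hexFrame b + U (hcpShift + ξ)‖ :=
  semOKH_forall h U ξ hsa hU ((inHcpBox_iff c w U ξ).2 ⟨hbox, hξ⟩) h0 h2

/-- ★ A box certified by ANY sound verdict (soundness in the `hver` shape at level `μ`) is semantically certified. [formal bookkeeping] -/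
theorem semOKH_of_sound {μ : ℤ} (verdict : ((Fin 3 × Fin 3) ⊕ Fin 3 → ℤ) → ((Fin 3 × Fin 3) ⊕ Fin 3 → ℤ) → Bool)
    (hver : ∀ c w, verdict c w = true → ∀ (U : E3 →L[ℝ] E3) (ξ : E3), (∀ v v' : E3, ⟪U v, v'⟫ = ⟪v, U v'⟫) → ‖U - 1‖ ≤ 1 / 4 →
      (∀ ab : Fin 3 × Fin 3, |(U (EuclideanSpace.single ab.2 (1 : ℝ))) ab.1 - (c (Sum.inl ab) : ℝ) / SC| ≤ (w (Sum.inl ab) : ℝ) / SC) →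
      (∀ i : Fin 3, |ξ i - (c (Sum.inr i) : ℝ) / SC| ≤ (w (Sum.inr i) : ℝ) / SC) → 0 ≤ ξ 0 → 0 ≤ ξ 2 → HcpLeafGoal μ U ξ)
    {c w : (Fin 3 × Fin 3) ⊕ Fin 3 → ℤ} (h : verdict c w = true) : semOKH μ c w = true :=
  semOKH_of_forall fun U ξ hsa hU hmem h0 h2 =>
    hver c w h U ξ hsa hU ((inHcpBox_iff c w U ξ).1 hmem).1 ((inHcpBox_iff c w U ξ).1 hmem).2 h0 h2

/-- ★ A cell passing the production verdict v3 `entryLeafOKHT4A2QQDCRS3 μ` is semantically certified at level `μ`. [formal bookkeeping] -/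
theorem semOKH_of_HT4A2QQDCRS3 {μ : ℤ} {c w : (Fin 3 × Fin 3) ⊕ Fin 3 → ℤ} (h : entryLeafOKHT4A2QQDCRS3 μ c w = true) : semOKH μ c w = true :=
  semOKH_of_sound (entryLeafOKHT4A2QQDCRS3 μ) (fun _ _ hv U ξ hsa hU hbox hξ h0 h2 => entryLeafOKHT4A2QQDCRS3_sound hv U ξ hsa hU hbox hξ h0 h2) h

/-- ★ A cell passing the level-closed verdict v4 `entryLeafOKHT4A2QQDCRS4 μ` is semantically certified at level `μ`. [formal bookkeeping] -/
theorem semOKH_of_HT4A2QQDCRS4 {μ : ℤ} {c w : (Fin 3 × Fin 3) ⊕ Fin 3 → ℤ} (h : entryLeafOKHT4A2QQDCRS4 μ c w = true) : semOKH μ c w = true :=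
  semOKH_of_sound (entryLeafOKHT4A2QQDCRS4 μ) (fun _ _ hv U ξ hsa hU hbox hξ h0 h2 => entryLeafOKHT4A2QQDCRS4_sound hv U ξ hsa hU hbox hξ h0 h2) h

/-- ★ **LEVEL ANTITONICITY**: a box certified at level `μ` is certified at every `μ' ≤ μ` (the energy disjunct weakens). [formal bookkeeping] -/
theorem semOKH_mono_level {μ μ' : ℤ} (hle : μ' ≤ μ) {c w : (Fin 3 × Fin 3) ⊕ Fin 3 → ℤ} (h : semOKH μ c w = true) : semOKH μ' c w = true :=
  semOKH_of_forall fun U ξ hsa hU hmem h0 h2 => hcpLeafGoal_mono hle (semOKH_forall h U ξ hsa hU hmem h0 h2)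

/-! ## §3. Geometry of boxes: containment and cuts at arbitrary integer points -/

/-- One coordinate: a point of the scaled interval `[c − w, c + w]` lies in `[a − b, a + b]` whenever `c − w ≥ a − b` and `c + w ≤ a + b` fail the other
way round — i.e. interval containment in integer endpoints transfers membership. [arithmetic] -/
theorem abs_sub_div_le_of_contained {x : ℝ} {c w c' w' : ℤ} (hlo : c - w ≤ c' - w') (hhi : c' + w' ≤ c + w)
    (hx : |x - (c' : ℝ) / SC| ≤ (w' : ℝ) / SC) : |x - (c : ℝ) / SC| ≤ (w : ℝ) / SC := by
  have hS : (0 : ℝ) < SC := SC_pos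
  rw [abs_sub_le_iff] at hx ⊢
  have e1 : ((c : ℝ) - w) / SC ≤ ((c' : ℝ) - w') / SC := by
    apply div_le_div_of_nonneg_right _ hS.le
    exact_mod_cast hlo
  have e2 : ((c' : ℝ) + w') / SC ≤ ((c : ℝ) + w) / SC := by
    apply div_le_div_of_nonneg_right _ hS.le
    exact_mod_cast hhi
  rw [sub_div, sub_div] at e1
  rw [add_div, add_div] at e2
  constructor <;> linarith [hx.1, hx.2]

/-- One coordinate, ★ THE CUT: a point of `[c − w, c + w]` lies in the left piece `[a − b, a + b]` or in the right piece `[a' − b', a' + b']` whenever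
`a − b = c − w`, `a + b = a' − b'` (the cut point) and `a' + b' = c + w`. [arithmetic] -/
theorem abs_sub_div_le_or_of_cut {x : ℝ} {c w a b a' b' : ℤ} (h1 : a - b = c - w) (h2 : a + b = a' - b') (h3 : a' + b' = c + w)
    (hx : |x - (c : ℝ) / SC| ≤ (w : ℝ) / SC) : |x - (a : ℝ) / SC| ≤ (b : ℝ) / SC ∨ |x - (a' : ℝ) / SC| ≤ (b' : ℝ) / SC := by
  have hS : (0 : ℝ) < SC := SC_pos
  rw [abs_sub_le_iff] at hx
  have e1 : ((a : ℝ) - b) / SC = ((c : ℝ) - w) / SC := by congr 1; exact_mod_cast h1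
  have e2 : ((a : ℝ) + b) / SC = ((a' : ℝ) - b') / SC := by congr 1; exact_mod_cast h2
  have e3 : ((a' : ℝ) + b') / SC = ((c : ℝ) + w) / SC := by congr 1; exact_mod_cast h3
  rw [sub_div, sub_div] at e1
  rw [add_div, sub_div] at e2
  rw [add_div, add_div] at e3
  by_cases hcut : x ≤ (a : ℝ) / SC + (b : ℝ) / SC
  · left
    rw [abs_sub_le_iff]
    constructor <;> linarith [hx.1, hx.2]
  · right
    rw [abs_sub_le_iff]
    have hcut' := not_le.mp hcut
    constructor <;> linarith [hx.1, hx.2]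

/-- ★ **BOX ANTITONICITY**: a certified box certifies every box it contains (integer endpoint containment on all twelve coordinates) — a landed cell serves
every partition piece inside it. [formal bookkeeping] -/
theorem semOKH_anti_box {μ : ℤ} {c w c' w' : (Fin 3 × Fin 3) ⊕ Fin 3 → ℤ} (hcont : ∀ k, c k - w k ≤ c' k - w' k ∧ c' k + w' k ≤ c k + w k)
    (h : semOKH μ c w = true) : semOKH μ c' w' = true :=
  semOKH_of_forall fun U ξ hsa hU hmem h0 h2 =>
    semOKH_forall h U ξ hsa hU (fun k => abs_sub_div_le_of_contained (hcont k).1 (hcont k).2 (hmem k)) h0 h2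

/-- ★★ **CUT GLUE AT AN ARBITRARY INTEGER CUT POINT** along coordinate `k`: the pieces `(cl, wl)` = `[c_k − w_k, p]` and `(cr, wr)` = `[p, c_k + w_k]`
(other coordinates unchanged; `p = a + b = a' − b'`), given LITERALLY as `Function.update`s with three linear integer side conditions, glue to the box
`(c, w)`.  The pieces need not be halves, so partitions can be laid AROUND sheet-centred cells. [formal bookkeeping] -/
theorem semOKH_of_cut {μ : ℤ} {c w cl wl cr wr : (Fin 3 × Fin 3) ⊕ Fin 3 → ℤ} (k : (Fin 3 × Fin 3) ⊕ Fin 3) {a b a' b' : ℤ}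
    (h1 : a - b = c k - w k) (h2 : a + b = a' - b') (h3 : a' + b' = c k + w k)
    (hcl : cl = Function.update c k a) (hwl : wl = Function.update w k b) (hcr : cr = Function.update c k a') (hwr : wr = Function.update w k b')
    (hl : semOKH μ cl wl = true) (hr : semOKH μ cr wr = true) : semOKH μ c w = true := by
  subst hcl hwl hcr hwr
  refine semOKH_of_forall fun U ξ hsa hU hmem hx0 hx2 => ?_
  rcases abs_sub_div_le_or_of_cut h1 h2 h3 (hmem k) with hk | hk
  · refine semOKH_forall hl U ξ hsa hU (fun j => ?_) hx0 hx2
    by_cases hj : j = k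
    · subst hj; simpa using hk
    · simpa [Function.update_of_ne hj] using hmem j
  · refine semOKH_forall hr U ξ hsa hU (fun j => ?_) hx0 hx2
    by_cases hj : j = k
    · subst hj; simpa using hk
    · simpa [Function.update_of_ne hj] using hmem j

/-- MIDPOINT HALVING is the special cut `p = c_k` (`w_k` even): the two `treeOK` children glue — so every `treeOK` tree re-assembles in the semantic currency.
[formal bookkeeping] -/
theorem semOKH_of_halves {μ : ℤ} {c w : (Fin 3 × Fin 3) ⊕ Fin 3 → ℤ} (k : (Fin 3 × Fin 3) ⊕ Fin 3) (hev : w k % 2 = 0)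
    (hl : semOKH μ (Function.update c k (c k - w k / 2)) (Function.update w k (w k / 2)) = true)
    (hr : semOKH μ (Function.update c k (c k + w k / 2)) (Function.update w k (w k / 2)) = true) : semOKH μ c w = true := by
  refine semOKH_of_cut k (a := c k - w k / 2) (b := w k / 2) (a' := c k + w k / 2) (b' := w k / 2) ?_ ?_ ?_ rfl rfl rfl rfl hl hr <;> omega

/-- ★ **EVERY CERTIFICATE TREE over a sound verdict is ONE semantic fact on its root box** (induction on the tree; leaves by `semOKH_of_sound`, splits by
`semOKH_of_halves`). [formal bookkeeping] -/
theorem semOKH_of_treeOK {μ : ℤ} (verdict : ((Fin 3 × Fin 3) ⊕ Fin 3 → ℤ) → ((Fin 3 × Fin 3) ⊕ Fin 3 → ℤ) → Bool)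
    (hver : ∀ c w, verdict c w = true → ∀ (U : E3 →L[ℝ] E3) (ξ : E3), (∀ v v' : E3, ⟪U v, v'⟫ = ⟪v, U v'⟫) → ‖U - 1‖ ≤ 1 / 4 →
      (∀ ab : Fin 3 × Fin 3, |(U (EuclideanSpace.single ab.2 (1 : ℝ))) ab.1 - (c (Sum.inl ab) : ℝ) / SC| ≤ (w (Sum.inl ab) : ℝ) / SC) →
      (∀ i : Fin 3, |ξ i - (c (Sum.inr i) : ℝ) / SC| ≤ (w (Sum.inr i) : ℝ) / SC) → 0 ≤ ξ 0 → 0 ≤ ξ 2 → HcpLeafGoal μ U ξ) :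
    ∀ (t : CertTree ((Fin 3 × Fin 3) ⊕ Fin 3)) (c w : (Fin 3 × Fin 3) ⊕ Fin 3 → ℤ), treeOK verdict t c w = true → semOKH μ c w = true
  | .leaf, c, w, h => semOKH_of_sound verdict hver (by simpa [treeOK] using h)
  | .split k l r, c, w, h => by
    simp only [treeOK, Bool.and_eq_true, decide_eq_true_eq] at h
    exact semOKH_of_halves k h.1.1 (semOKH_of_treeOK verdict hver l _ _ h.1.2) (semOKH_of_treeOK verdict hver r _ _ h.2)

/-- ★ The ∃-tree currency of the cells over v3 (`okS3_… : ∃ t, treeOK (entryLeafOKHT4A2QQDCRS3 μ) t c w = true`) IS a semantic fact. [formal bookkeeping] -/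
theorem semOKH_of_exists_tree3 {μ : ℤ} {c w : (Fin 3 × Fin 3) ⊕ Fin 3 → ℤ}
    (h : ∃ t : CertTree ((Fin 3 × Fin 3) ⊕ Fin 3), treeOK (entryLeafOKHT4A2QQDCRS3 μ) t c w = true) : semOKH μ c w = true := by
  obtain ⟨t, ht⟩ := h
  exact semOKH_of_treeOK (entryLeafOKHT4A2QQDCRS3 μ) (fun _ _ hv U ξ hsa hU hbox hξ h0 h2 => entryLeafOKHT4A2QQDCRS3_sound hv U ξ hsa hU hbox hξ h0 h2) t c w ht

/-- ★ The ∃-tree currency over the level-closed verdict v4 IS a semantic fact. [formal bookkeeping] -/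
theorem semOKH_of_exists_tree4 {μ : ℤ} {c w : (Fin 3 × Fin 3) ⊕ Fin 3 → ℤ}
    (h : ∃ t : CertTree ((Fin 3 × Fin 3) ⊕ Fin 3), treeOK (entryLeafOKHT4A2QQDCRS4 μ) t c w = true) : semOKH μ c w = true := by
  obtain ⟨t, ht⟩ := h
  exact semOKH_of_treeOK (entryLeafOKHT4A2QQDCRS4 μ) (fun _ _ hv U ξ hsa hU hbox hξ h0 h2 => entryLeafOKHT4A2QQDCRS4_sound hv U ξ hsa hU hbox hξ h0 h2) t c w ht

/-- ★ A `muRec`-stated cell (every landed `okS3_…`) is a semantic fact at EVERY level `μ ≤ muRec` — e.g. `μ₇₈`. [formal bookkeeping] -/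
theorem semOKH_of_exists_tree3_level {μ μ₀ : ℤ} (hle : μ ≤ μ₀) {c w : (Fin 3 × Fin 3) ⊕ Fin 3 → ℤ}
    (h : ∃ t : CertTree ((Fin 3 × Fin 3) ⊕ Fin 3), treeOK (entryLeafOKHT4A2QQDCRS3 μ₀) t c w = true) : semOKH μ c w = true :=
  semOKH_mono_level hle (semOKH_of_exists_tree3 h)

/-! ## §4. Root consumers -/

/-- A semantic root fact is a one-leaf `treeOK` tree over the semantic verdict. [formal bookkeeping] -/
theorem treeOK_leaf_semOKH {μ : ℤ} {c w : (Fin 3 × Fin 3) ⊕ Fin 3 → ℤ} (h : semOKH μ c w = true) : treeOK (semOKH μ) .leaf c w = true := by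
  simpa [treeOK] using h

/-- ★★★ **THE hcp HALF FROM THE ONE SEMANTIC ROOT FACT** `semOKH μ rootCH rootWH = true` (every `m` with `2 (m + e_W) SC ≤ μ`). [folklore chaining] -/
theorem hcpHalf_of_semOKH {m : ℝ} {μ : ℤ} (hμ : 2 * (m + (-(7175 / 10000) + 3 / 400)) * SC ≤ μ) (h : semOKH μ rootCH rootWH = true) :
    ∀ (U : E3 →L[ℝ] E3) (ξ : E3), (∀ v w : E3, inner ℝ (U v) w = inner ℝ v (U w)) → (∀ w : E3, 0 ≤ inner ℝ w (U w)) →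
      ‖U - 1‖ ≤ 1 / 4 → ‖ξ‖ ≤ 1 / 4 → HcpDich m U ξ :=
  hcpHalf_of_entryTreeShuf hμ (semOKH μ) (fun _ _ hv U ξ hsa hU hbox hξ h0 h2 => semOKH_sound hv U ξ hsa hU hbox hξ h0 h2) (treeOK_leaf_semOKH h)

/-- ★★★ **`(H) HomFloor m` FROM THE fcc ∃-TREE OVER THE LEVEL-CLOSED VERDICT v4 AND THE hcp SEMANTIC ROOT FACT** at any level `μ` with `2 (m + e_W) SC ≤ μ`.
[folklore] -/
theorem homFloor_of_entryTree6RBKP4_semOKH {m : ℝ} {μ : ℤ} (hμ : 2 * (m + (-(7175 / 10000) + 3 / 400)) * SC ≤ μ)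
    (hF : ∃ t : CertTree (Fin 3 × Fin 3), treeOK (entryLeafOK6RBKP4 μ) t rootC rootW = true) (hH : semOKH μ rootCH rootWH = true) : HomFloor m := by
  obtain ⟨tF, htF⟩ := hF
  exact homFloor_of_prunedBoxSums_selfAdjoint (fccHalf_of_entryTree6RBKP4 hμ htF) (hcpHalf_of_semOKH hμ hH)

/-- CONTAINMENT at the root: the tree-shaped hcp root hypothesis of record (v4) yields the semantic one — nothing typed so far is lost. [formal bookkeeping] -/
theorem semOKH_root_of_exists_tree4 {μ : ℤ}
    (hH : ∃ t : CertTree ((Fin 3 × Fin 3) ⊕ Fin 3), treeOK (entryLeafOKHT4A2QQDCRS4 μ) t rootCH rootWH = true) : semOKH μ rootCH rootWH = true :=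
  semOKH_of_exists_tree4 hH

/-- … and conversely the semantic root fact IS an ∃-tree fact over the semantic verdict (for consumers stated with trees). [formal bookkeeping] -/
theorem exists_tree_semOKH_of_semOKH {μ : ℤ} {c w : (Fin 3 × Fin 3) ⊕ Fin 3 → ℤ} (h : semOKH μ c w = true) :
    ∃ t : CertTree ((Fin 3 × Fin 3) ⊕ Fin 3), treeOK (semOKH μ) t c w = true :=
  ⟨.leaf, treeOK_leaf_semOKH h⟩

end Summit.AtomisticToContinuum.Crystallization.Theorems.FrustratedLawDichotomyStrainedPatchHomEntryLeafHT

end
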